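import Summits.MatrixMultiplication.OmegaCensus.STPP222Pow7From362
import Summits.MatrixMultiplication.OmegaCensus.STPP222Pow8From530

/-!
# ω-census, `N₇` / `N₈` assemblies with SEEDS: generic threshold theorems over the landed checkers `coveredG` / `covered8`

HONEST FRAMING (pub-omega census; verbatim): lottery ticket; floor = certified bounds/negative ranges.
Census STRUCTURE bookkeeping (question Q7 of the pub-omega cell, the uniform thresholds `N₇`, `N₈` for seven / eight simultaneous-TPP
triples of 2-subsets, CKSU 2005 Def. 5.1, tree form `IsSTPP`), not progress on `ω`: a `(2,2,2)^k` family certifies no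
matrix-multiplication bound of interest.

`STPP222Pow7From362.lean` (`N₇ ≤ 362`) and `STPP222Pow8From530.lean` (`N₈ ≤ 530`) decide the routes of capped multisets with the
generic checkers `NkRoutes.coveredG [] 7` / `N8Routes.covered8 [] 8` and NO seed shapes; `362 = 1 + |ℤ/19²|` and `530 = 1 + |ℤ/23²|` are
only the largest abelian types without a route, and the checkers already accept a list of seed SHAPES whose soundness hypothesis
(`coveredG_sound` / `covered8_sound`: every shape hosts `(2,2,2)^k`) is vacuous for `[]`.  This file turns the two assemblies into
theorems GENERIC in the threshold `T`, the shape list and the cap function, exactly as `STPP222Pow6SeededRoutes.lean` does for `k = 6`: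

* the capping data is an arbitrary function `capList : ℕ → List (ℕ × ℕ)` (exponent `E ↦` list of (prime power, cap)); the only
  requirement is `hcap`: for every prime power `v ≤ 199` (resp. `≤ 215`) dividing `E`, `v ^ (multiplicity of v in capMS (capList E)) ≥ T`
  — so a decision file defines its capping list locally (standard choice: `(ppList199.filter (· ∣ E)).map fun v => (v, cap v)`);
* `exists_isSTPP_222pow7_of_card_ge_of_seededDecision T shapes capList hshapes hcap hdec` — **every finite abelian group of order `≥ T`
  admits `(2,2,2)⁷`**, given: the shapes host `(2,2,2)⁷`, `hcap` on `ppList199`, and the decision "every sub-multiset of `capMS (capList E)`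
  of product `≥ T` is `coveredG shapes 7`" for all exponents `E ≤ 199` (exponent `≥ 200`: the cyclic law
  `exists_isSTPP_2227_of_exponent_ge200`);
* `exists_isSTPP_222pow8_of_card_ge_of_seededDecision` — the same for `(2,2,2)⁸` over `ppList215`, `covered8 shapes 8`, exponents
  `E ≤ 215` (exponent `≥ 216`: the base-3 cyclic law `exists_isSTPP_222pow_of_exponent_ge_two_pow 3 8`).

A concrete threshold file then only lists its seeds (kernel witnesses; a `(2,2,2)⁸` witness serves `k = 7` too by `N5Kit.hasPow_mono`) and
runs `decide`.  Planner / generator: the seat's `model78s.py` / `gen78s.py` (HOME `pub-omega-stpp-3-g12/code/gen/`).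

References: H. Cohn, R. Kleinberg, B. Szegedy, C. Umans, FOCS 2005 (arXiv:math/0511460), Def. 5.1; J. Blasiak et al., Discrete
Analysis 2017:3, Def. 3.1.  Seat pub-omega-stpp-3 (gen 12), 2026-08-25.
-/

open Literature.Computability.AlgebraicComplexity Literature.Combinatorics.Additive Finset

namespace Summit.MatrixMultiplication.OmegaCensus

namespace N78Seeded

open N5Kit N5From94 NkRoutes N8Routes N7From362 N8From530

/-! ## 1. `k = 7` -/

/-- **Seeded `N₇` assembly, exponents `≤ 199`.**  Shapes host `(2,2,2)⁷`, caps large enough, decision over `capList E` ⇒ every finite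
abelian group of order `≥ T` and exponent `≤ 199` admits `(2,2,2)⁷` (structure theorem, capping, decision, `coveredG_sound` on the sub-block
carrying the capped multiset, transport). [cite: CohnKleinbergSzegedyUmans2005, Def. 5.1] -/
theorem hasPow7_of_card_ge_of_exponent_le (T : ℕ) (shapes : List (List ℕ)) (capList : ℕ → List (ℕ × ℕ))
    (hshapes : ∀ s ∈ shapes, HasPow (SeedType s) 7)
    (hcap : ∀ E ∈ List.range' 1 199, ∀ v ∈ ppList199, v ∣ E → T ≤ v ^ Multiset.count v (capMS (capList E)))
    (hdec : ∀ E ∈ List.range' 1 199, ∀ M ∈ subMS (capList E), T ≤ M.prod → coveredG shapes 7 M = true)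
    {G : Type*} [AddCommGroup G] [Finite G] (hE : AddMonoid.exponent G ≤ 199) (hG : T ≤ Nat.card G) : HasPow G 7 := by
  classical
  obtain ⟨ι, _, p, hp, e, ⟨f₀⟩⟩ := AddCommGroup.equiv_directSum_zmod_of_finite G
  let f : G ≃+ (Π i, ZMod (p i ^ e i)) :=
    f₀.trans (DirectSum.linearEquivFunOnFintype ℕ ι (fun i => ZMod (p i ^ e i))).toAddEquiv
  set E := AddMonoid.exponent G with hEdef
  have hE1 : 1 ≤ E := Nat.pos_of_ne_zero AddMonoid.exponent_ne_zero_of_finite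
  have hq0 : ∀ i, 0 < p i ^ e i := fun i => pow_pos (hp i).pos _
  have hdvd : ∀ i, p i ^ e i ∣ E := fun i => by
    have hinj : Function.Injective (AddMonoidHom.single (fun j => ZMod (p j ^ e j)) i) :=
      Pi.single_injective (M := fun j => ZMod (p j ^ e j)) i
    have h1 : addOrderOf (f.symm (AddMonoidHom.single (fun j => ZMod (p j ^ e j)) i 1)) = p i ^ e i := by
      rw [AddEquiv.addOrderOf_eq, addOrderOf_injective _ hinj, ZMod.addOrderOf_one]
    rw [← h1]
    exact AddMonoid.addOrder_dvd_exponent _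
  set S₀ : Finset ι := Finset.univ.filter fun i => 0 < e i with hS₀
  set M : Multiset ℕ := S₀.val.map (fun i => p i ^ e i) with hM
  have hprod : T ≤ M.prod := by
    have h1 : M.prod = ∏ i, p i ^ e i := by
      rw [hM, N5Kit.prod_map_val]
      exact Finset.prod_filter_of_ne fun i _ hi => Nat.pos_of_ne_zero fun h0 => hi (by rw [h0, pow_zero])
    have h2 : Nat.card G = ∏ i, p i ^ e i := by
      rw [Nat.card_congr f.toEquiv, Nat.card_pi]
      simp [Nat.card_zmod]
    rw [h1, ← h2]; exact hG
  have hmem : ∀ a ∈ M, a ∈ ppList199 ∧ a ∣ E := by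
    intro a ha
    obtain ⟨i, hi, rfl⟩ := Multiset.mem_map.1 ha
    have hi' : 0 < e i := (Finset.mem_filter.1 hi).2
    exact ⟨pow_mem_ppList199 (hp i) hi' (le_trans (Nat.le_of_dvd (by omega) (hdvd i)) (by omega)), hdvd i⟩
  have hEI : E ∈ List.range' 1 199 := List.mem_range'_1.2 ⟨hE1, by omega⟩
  set C := capMS (capList E) with hC
  have hcapd : T ≤ (M ∩ C).prod := prod_inter_ge_of hprod (fun a ha => one_le_of_mem_ppList199 (hmem a ha).1)
    (fun a ha => hcap E hEI a (hmem a ha).1 (hmem a ha).2)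
  have hMC : M ∩ C ∈ subMS (capList E) := mem_subMS_of_le _ _ Multiset.inter_le_right
  have hcov : coveredG shapes 7 (M ∩ C) = true := hdec E hEI (M ∩ C) hMC hcapd
  obtain ⟨S₁, -, hS₁⟩ := exists_subset_map_eq (fun i => p i ^ e i) S₀ (M ∩ C) Multiset.inter_le_left
  rw [← hS₁] at hcov
  have h7 : HasPow (Π i, ZMod (p i ^ e i)) 7 := coveredG_sound hshapes hq0 S₁ hcov
  exact hasPow_map f.symm.toAddMonoidHom f.symm.injective h7

/-- **Seeded `N₇` assembly (generic threshold).**  For ANY threshold `T`, shape list and capping list: if every shape hosts `(2,2,2)⁷`,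
the caps satisfy `v ^ cap-count ≥ T` for the prime powers `≤ 199` dividing each exponent `E ≤ 199`, and every capped multiset of product
`≥ T` is `coveredG shapes 7` for every `E ≤ 199`, then **every finite abelian group of order `≥ T` admits seven simultaneous-TPP triples of
2-subsets** (CKSU 2005 Def. 5.1, tree form `IsSTPP`).  Exponent `≥ 200`: the cyclic law `exists_isSTPP_2227_of_exponent_ge200`; otherwise
`hasPow7_of_card_ge_of_exponent_le`.  No sharpness and no `ω` bound claimed. [cite: CohnKleinbergSzegedyUmans2005, Def. 5.1] -/
theorem exists_isSTPP_222pow7_of_card_ge_of_seededDecision (T : ℕ) (shapes : List (List ℕ)) (capList : ℕ → List (ℕ × ℕ))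
    (hshapes : ∀ s ∈ shapes, HasPow (SeedType s) 7)
    (hcap : ∀ E ∈ List.range' 1 199, ∀ v ∈ ppList199, v ∣ E → T ≤ v ^ Multiset.count v (capMS (capList E)))
    (hdec : ∀ E ∈ List.range' 1 199, ∀ M ∈ subMS (capList E), T ≤ M.prod → coveredG shapes 7 M = true)
    {G : Type*} [AddCommGroup G] [Finite G] (hG : T ≤ Nat.card G) :
    ∃ A B C : Fin 7 → Finset G, IsSTPP A B C ∧ ∀ i, (A i).card = 2 ∧ (B i).card = 2 ∧ (C i).card = 2 := by
  by_cases h200 : 200 ≤ AddMonoid.exponent G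
  · exact exists_isSTPP_2227_of_exponent_ge200 h200
  exact hasPow7_of_card_ge_of_exponent_le T shapes capList hshapes hcap hdec (by omega) hG

/-! ## 2. `k = 8` -/

/-- **Seeded `N₈` assembly, exponents `≤ 215`** (as `hasPow7_of_card_ge_of_exponent_le`, over `ppList215` and `covered8 shapes 8`).
[cite: CohnKleinbergSzegedyUmans2005, Def. 5.1] -/
theorem hasPow8_of_card_ge_of_exponent_le (T : ℕ) (shapes : List (List ℕ)) (capList : ℕ → List (ℕ × ℕ))
    (hshapes : ∀ s ∈ shapes, HasPow (SeedType s) 8)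
    (hcap : ∀ E ∈ List.range' 1 215, ∀ v ∈ ppList215, v ∣ E → T ≤ v ^ Multiset.count v (capMS (capList E)))
    (hdec : ∀ E ∈ List.range' 1 215, ∀ M ∈ subMS (capList E), T ≤ M.prod → covered8 shapes 8 M = true)
    {G : Type*} [AddCommGroup G] [Finite G] (hE : AddMonoid.exponent G ≤ 215) (hG : T ≤ Nat.card G) : HasPow G 8 := by
  classical
  obtain ⟨ι, _, p, hp, e, ⟨f₀⟩⟩ := AddCommGroup.equiv_directSum_zmod_of_finite G
  let f : G ≃+ (Π i, ZMod (p i ^ e i)) :=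
    f₀.trans (DirectSum.linearEquivFunOnFintype ℕ ι (fun i => ZMod (p i ^ e i))).toAddEquiv
  set E := AddMonoid.exponent G with hEdef
  have hE1 : 1 ≤ E := Nat.pos_of_ne_zero AddMonoid.exponent_ne_zero_of_finite
  have hq0 : ∀ i, 0 < p i ^ e i := fun i => pow_pos (hp i).pos _
  have hdvd : ∀ i, p i ^ e i ∣ E := fun i => by
    have hinj : Function.Injective (AddMonoidHom.single (fun j => ZMod (p j ^ e j)) i) :=
      Pi.single_injective (M := fun j => ZMod (p j ^ e j)) i
    have h1 : addOrderOf (f.symm (AddMonoidHom.single (fun j => ZMod (p j ^ e j)) i 1)) = p i ^ e i := by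
      rw [AddEquiv.addOrderOf_eq, addOrderOf_injective _ hinj, ZMod.addOrderOf_one]
    rw [← h1]
    exact AddMonoid.addOrder_dvd_exponent _
  set S₀ : Finset ι := Finset.univ.filter fun i => 0 < e i with hS₀
  set M : Multiset ℕ := S₀.val.map (fun i => p i ^ e i) with hM
  have hprod : T ≤ M.prod := by
    have h1 : M.prod = ∏ i, p i ^ e i := by
      rw [hM, N5Kit.prod_map_val]
      exact Finset.prod_filter_of_ne fun i _ hi => Nat.pos_of_ne_zero fun h0 => hi (by rw [h0, pow_zero])
    have h2 : Nat.card G = ∏ i, p i ^ e i := by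
      rw [Nat.card_congr f.toEquiv, Nat.card_pi]
      simp [Nat.card_zmod]
    rw [h1, ← h2]; exact hG
  have hmem : ∀ a ∈ M, a ∈ ppList215 ∧ a ∣ E := by
    intro a ha
    obtain ⟨i, hi, rfl⟩ := Multiset.mem_map.1 ha
    have hi' : 0 < e i := (Finset.mem_filter.1 hi).2
    exact ⟨pow_mem_ppList215 (hp i) hi' (le_trans (Nat.le_of_dvd (by omega) (hdvd i)) (by omega)), hdvd i⟩
  have hEI : E ∈ List.range' 1 215 := List.mem_range'_1.2 ⟨hE1, by omega⟩
  set C := capMS (capList E) with hC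
  have hcapd : T ≤ (M ∩ C).prod := prod_inter_ge_of hprod (fun a ha => one_le_of_mem_ppList215 (hmem a ha).1)
    (fun a ha => hcap E hEI a (hmem a ha).1 (hmem a ha).2)
  have hMC : M ∩ C ∈ subMS (capList E) := mem_subMS_of_le _ _ Multiset.inter_le_right
  have hcov : covered8 shapes 8 (M ∩ C) = true := hdec E hEI (M ∩ C) hMC hcapd
  obtain ⟨S₁, -, hS₁⟩ := exists_subset_map_eq (fun i => p i ^ e i) S₀ (M ∩ C) Multiset.inter_le_left
  rw [← hS₁] at hcov
  have h8 : HasPow (Π i, ZMod (p i ^ e i)) 8 := covered8_sound hshapes hq0 S₁ hcov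
  exact hasPow_map f.symm.toAddMonoidHom f.symm.injective h8

/-- **Seeded `N₈` assembly (generic threshold).**  For ANY threshold `T`, shape list and capping list: shapes host `(2,2,2)⁸`, caps
`v ^ cap-count ≥ T` over `ppList215` for each exponent `E ≤ 215`, and every capped multiset of product `≥ T` is `covered8 shapes 8` ⇒ **every
finite abelian group of order `≥ T` admits eight simultaneous-TPP triples of 2-subsets** (CKSU 2005 Def. 5.1, tree form `IsSTPP`).
Exponent `≥ 216`: the base-3 cyclic law `exists_isSTPP_222pow_of_exponent_ge_two_pow 3 8`; otherwise `hasPow8_of_card_ge_of_exponent_le`.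
No sharpness and no `ω` bound claimed. [cite: CohnKleinbergSzegedyUmans2005, Def. 5.1] -/
theorem exists_isSTPP_222pow8_of_card_ge_of_seededDecision (T : ℕ) (shapes : List (List ℕ)) (capList : ℕ → List (ℕ × ℕ))
    (hshapes : ∀ s ∈ shapes, HasPow (SeedType s) 8)
    (hcap : ∀ E ∈ List.range' 1 215, ∀ v ∈ ppList215, v ∣ E → T ≤ v ^ Multiset.count v (capMS (capList E)))
    (hdec : ∀ E ∈ List.range' 1 215, ∀ M ∈ subMS (capList E), T ≤ M.prod → covered8 shapes 8 M = true)
    {G : Type*} [AddCommGroup G] [Finite G] (hG : T ≤ Nat.card G) :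
    ∃ A B C : Fin 8 → Finset G, IsSTPP A B C ∧ ∀ i, (A i).card = 2 ∧ (B i).card = 2 ∧ (C i).card = 2 := by
  by_cases h216 : 216 ≤ AddMonoid.exponent G
  · exact exists_isSTPP_222pow_of_exponent_ge_two_pow 3 8 (by norm_num) (le_trans (by norm_num) h216)
  exact hasPow8_of_card_ge_of_exponent_le T shapes capList hshapes hcap hdec (by omega) hG

end N78Seeded

end Summit.MatrixMultiplication.OmegaCensus
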